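import Literature.Probability.MarkovChains.MetropolisHastings
import HarnessLib

/-!
# The replica-exchange (parallel-tempering) move: acceptance rule and detailed balance

Topic `Literature/Probability/MarkovChains`.  Source: K. Hukushima, K. Nemoto, *Exchange Monte
Carlo method and application to spin glass simulations*, J. Phys. Soc. Jpn. **65**, 1604–1608
(1996) = arXiv:cond-mat/9512035, §2 ‘Exchange MC method’ [HukushimaNemoto1996] (held text
`paper:arxiv-cond-mat_9512035`, chunk p0004): the compound system of `M` non-interacting replicas
at inverse temperatures `β_1, …, β_M` with the product law
`P({X, β}) = ∏_m P_eq(X_m, β_m)`, `P_eq(X, β) = Z(β)⁻¹ exp(−β 𝓗(X))` (eqs. (2)–(3) of §2), the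
exchange of the configurations of two replicas with transition probability `W(X, β_m | X', β_n)`
subject to “the detailed balance condition on the transition matrix:
P(…; X, β_m; …; X', β_n; …) W(X, β_m | X', β_n) = P(…; X', β_m; …; X, β_n; …) W(X', β_m | X, β_n)”
(eq. (4)), whence “W(X, β_m | X', β_n) / W(X', β_m | X, β_n) = exp(−Δ), where
Δ = (β_n − β_m)(𝓗(X) − 𝓗(X'))” (eqs. (5)–(6)) and “W(X, β_m | X', β_n) = 1 for Δ < 0,
exp(−Δ) for Δ > 0, if one adopts the Metropolis method” (eq. (7)).  Equation numbers are those of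
the arXiv text's §2 in order of appearance.

HONEST FRAMING (pub-qadeq lane context, CLAIMS rows E-19 / E-29 / E-31 / E-42 / E-43 and the S-10 /
S-13 lines, whose classical comparators are parallel-tempering codes — PT-ICM, APT, ‘own enhanced
PT’, and the native-HUBO SA/PT plan of S-13): instance-level adjudication of specific advantage
claims; no claim about BQP vs BPP or the summit.  This file types the exchange move and proves the
property the comparators rely on (it leaves the product Gibbs law invariant); it says nothing about
mixing times, temperature ladders, or any benchmark.

## Contents (all proved, 0 named facts)

* `boltzmann H β X = exp(−β H X)`, `extWeight H β X = ∏_m exp(−β_m H(X_m))` (the extended-ensemble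
  weight, eqs. (1)–(3) unnormalised), `exchange m n X` (configurations of replicas `m`, `n`
  swapped), `delta H β m n X = (β_n − β_m)(H(X_m) − H(X_n))` (eq. (6)), `acceptance = min{1, e^{−Δ}}`
  (eq. (7)).
* **`extWeight_exchange`** — `P(X') = e^{−Δ} P(X)` (the ratio behind eq. (5)); `delta_exchange`
  (`Δ(X') = −Δ(X)`); **`detailedBalance_exchange`** — eq. (4) holds for the Metropolis choice (7):
  `P(X) W(X → X') = P(X') W(X' → X)`.
* The move as a Markov kernel on the extended state space: `exchangeProposal m n` (propose the
  swap with probability one — a symmetric proposal), `exchangeKernel` = the tree's Metropolis–Hastings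
  kernel `mhKernel (exchangeProposal m n) (extWeight H β)`; `exchangeKernel_apply` — its off-diagonal
  entry IS the acceptance (7); **`extWeight_isStationary_exchangeKernel`** — the product Gibbs weight
  is stationary (and `exchangeKernel_detailedBalance`), by the tree's `mhKernel_isStationary` /
  `mhRate_of_symm` [cite: GubernatisKawashimaWerner2016, §2.5.1–§2.5.2].
-/

noncomputable section

namespace Literature.Probability.MarkovChains.ReplicaExchange

open Finset Real Literature.Probability.MarkovChains

variable {C : Type*} {M : ℕ}

/-! ## The extended ensemble and the exchange move -/

/-- The Boltzmann weight `exp(−β 𝓗(X))` of one replica (eq. (3), unnormalised).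
[cite: HukushimaNemoto1996, §2 eq. (3)] -/
def boltzmann (H : C → ℝ) (β : ℝ) (X : C) : ℝ := Real.exp (-(β * H X))

/-- The extended-ensemble weight of the compound system of `M` replicas,
`∏_m exp(−β_m 𝓗(X_m))` (eqs. (1)–(2), unnormalised). [cite: HukushimaNemoto1996, §2 eqs. (1)–(2)] -/
def extWeight (H : C → ℝ) (β : Fin M → ℝ) (X : Fin M → C) : ℝ := ∏ m, boltzmann H (β m) (X m)

/-- `P({X}) > 0`. [cite: HukushimaNemoto1996, §2 eq. (2)] -/
theorem extWeight_pos (H : C → ℝ) (β : Fin M → ℝ) (X : Fin M → C) : 0 < extWeight H β X :=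
  prod_pos fun _ _ => Real.exp_pos _

/-- `∏_m exp(−β_m 𝓗(X_m)) = exp(−Σ_m β_m 𝓗(X_m))` (the exponent of eq. (1)).
[cite: HukushimaNemoto1996, §2 eq. (1)] -/
theorem extWeight_eq_exp (H : C → ℝ) (β : Fin M → ℝ) (X : Fin M → C) :
    extWeight H β X = Real.exp (-(∑ m, β m * H (X m))) := by
  unfold extWeight boltzmann
  rw [← sum_neg_distrib, Real.exp_sum]

/-- Exchanging the configurations of replicas `m` and `n`: `X'_m = X_n`, `X'_n = X_m`, all other
replicas unchanged. [cite: HukushimaNemoto1996, §2 (“exchanging configurations of the n-th and m-th replicas”)] -/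
def exchange (m n : Fin M) (X : Fin M → C) : Fin M → C := fun k => X (Equiv.swap m n k)

/-- `X'_m = X_n`. [cite: HukushimaNemoto1996, §2] -/
theorem exchange_apply_left (m n : Fin M) (X : Fin M → C) : exchange m n X m = X n := by
  simp [exchange]

/-- `X'_n = X_m`. [cite: HukushimaNemoto1996, §2] -/
theorem exchange_apply_right (m n : Fin M) (X : Fin M → C) : exchange m n X n = X m := by
  simp [exchange]

/-- Other replicas are untouched. [cite: HukushimaNemoto1996, §2] -/
theorem exchange_apply_of_ne {m n k : Fin M} (hm : k ≠ m) (hn : k ≠ n) (X : Fin M → C) :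
    exchange m n X k = X k := by
  simp [exchange, Equiv.swap_apply_of_ne_of_ne hm hn]

/-- Exchanging twice restores the state. [cite: HukushimaNemoto1996, §2] -/
theorem exchange_exchange (m n : Fin M) (X : Fin M → C) : exchange m n (exchange m n X) = X := by
  funext k; simp [exchange, Equiv.swap_apply_self]

/-- `Δ = (β_n − β_m)(𝓗(X_m) − 𝓗(X_n))`. [cite: HukushimaNemoto1996, §2 eq. (6)] -/
def delta (H : C → ℝ) (β : Fin M → ℝ) (m n : Fin M) (X : Fin M → C) : ℝ :=
  (β n - β m) * (H (X m) - H (X n))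

/-- After the exchange `Δ` changes sign. [cite: HukushimaNemoto1996, §2 eq. (6)] -/
theorem delta_exchange (H : C → ℝ) (β : Fin M → ℝ) (m n : Fin M) (X : Fin M → C) :
    delta H β m n (exchange m n X) = -delta H β m n X := by
  unfold delta; rw [exchange_apply_left, exchange_apply_right]; ring

/-- **The weight ratio of the exchange**: `P(…; X_n, β_m; …; X_m, β_n; …) = e^{−Δ} · P(…; X_m, β_m;
…; X_n, β_n; …)` — the identity “from eq. (2) we obtain W/W' = exp(−Δ)” rests on.
[cite: HukushimaNemoto1996, §2 eqs. (5)–(6)] -/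
theorem extWeight_exchange (H : C → ℝ) (β : Fin M → ℝ) {m n : Fin M} (hmn : m ≠ n)
    (X : Fin M → C) :
    extWeight H β (exchange m n X) = Real.exp (-delta H β m n X) * extWeight H β X := by
  classical
  rw [extWeight_eq_exp, extWeight_eq_exp, ← Real.exp_add]
  congr 1
  -- the exponents differ only in the two exchanged terms
  have hdiff : ∑ k, β k * H (exchange m n X k) - ∑ k, β k * H (X k) = delta H β m n X := by
    rw [← sum_sub_distrib]
    rw [sum_eq_add_of_mem m n (mem_univ m) (mem_univ n) hmn]
    · rw [exchange_apply_left, exchange_apply_right]; unfold delta; ring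
    · intro k _ hk
      rw [exchange_apply_of_ne hk.1 hk.2, sub_self]
  linarith

/-! ## The Metropolis acceptance (7) and the detailed balance condition (4) -/

/-- The Metropolis acceptance probability of the exchange, `W = 1` for `Δ ≤ 0` and `e^{−Δ}` for
`Δ > 0`, i.e. `min{1, e^{−Δ}}`. [cite: HukushimaNemoto1996, §2 eq. (7)] -/
def acceptance (H : C → ℝ) (β : Fin M → ℝ) (m n : Fin M) (X : Fin M → C) : ℝ :=
  min 1 (Real.exp (-delta H β m n X))

/-- Case `Δ ≤ 0` of eq. (7): accept surely. [cite: HukushimaNemoto1996, §2 eq. (7)] -/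
theorem acceptance_of_nonpos {H : C → ℝ} {β : Fin M → ℝ} {m n : Fin M} {X : Fin M → C}
    (h : delta H β m n X ≤ 0) : acceptance H β m n X = 1 :=
  min_eq_left (Real.one_le_exp (by linarith))

/-- Case `Δ > 0` of eq. (7) (indeed `Δ ≥ 0`): accept with probability `e^{−Δ}`.
[cite: HukushimaNemoto1996, §2 eq. (7)] -/
theorem acceptance_of_nonneg {H : C → ℝ} {β : Fin M → ℝ} {m n : Fin M} {X : Fin M → C}
    (h : 0 ≤ delta H β m n X) : acceptance H β m n X = Real.exp (-delta H β m n X) :=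
  min_eq_right (Real.exp_le_one_iff.mpr (by linarith))

/-- `0 ≤ W ≤ 1`. [cite: HukushimaNemoto1996, §2 eq. (7)] -/
theorem acceptance_nonneg (H : C → ℝ) (β : Fin M → ℝ) (m n : Fin M) (X : Fin M → C) :
    0 ≤ acceptance H β m n X :=
  le_min zero_le_one (Real.exp_pos _).le

/-- `W ≤ 1`. [cite: HukushimaNemoto1996, §2 eq. (7)] -/
theorem acceptance_le_one (H : C → ℝ) (β : Fin M → ℝ) (m n : Fin M) (X : Fin M → C) :
    acceptance H β m n X ≤ 1 :=
  min_le_left _ _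

/-- **Detailed balance of the replica exchange** (eq. (4) with the Metropolis choice (7)):
`P(X) · W(X → X') = P(X') · W(X' → X)` where `X'` is `X` with replicas `m`, `n` exchanged.
[cite: HukushimaNemoto1996, §2 eqs. (4), (7)] -/
theorem detailedBalance_exchange (H : C → ℝ) (β : Fin M → ℝ) {m n : Fin M} (hmn : m ≠ n)
    (X : Fin M → C) :
    extWeight H β X * acceptance H β m n X =
      extWeight H β (exchange m n X) * acceptance H β m n (exchange m n X) := by
  rw [extWeight_exchange H β hmn]
  unfold acceptance
  rw [delta_exchange, neg_neg]
  set d := delta H β m n X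
  set w := extWeight H β X
  rcases le_total 0 d with hd | hd
  · rw [min_eq_right (Real.exp_le_one_iff.mpr (by linarith)),
      min_eq_left (Real.one_le_exp hd)]
    ring
  · rw [min_eq_left (Real.one_le_exp (by linarith : 0 ≤ -d)),
      min_eq_right (Real.exp_le_one_iff.mpr hd)]
    rw [mul_one, mul_assoc, mul_comm w, ← mul_assoc, ← Real.exp_add, neg_add_cancel,
      Real.exp_zero, one_mul]

/-! ## The exchange move as a Metropolis–Hastings kernel on the extended state space -/

section Kernel

variable [Fintype C] [DecidableEq C]

/-- The exchange PROPOSAL: from `X` propose `X'` (replicas `m`, `n` exchanged) with probability one.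
[cite: HukushimaNemoto1996, §2 (step 2 of the procedure: “Exchange of two configurations X_m and X_{m+1} is tried”)] -/
def exchangeProposal (m n : Fin M) (X Y : Fin M → C) : ℝ := if Y = exchange m n X then 1 else 0

omit [Fintype C] in
/-- The proposal is symmetric (the exchange is an involution). [cite: HukushimaNemoto1996, §2] -/
theorem exchangeProposal_symm (m n : Fin M) (X Y : Fin M → C) :
    exchangeProposal m n X Y = exchangeProposal m n Y X := by
  unfold exchangeProposal
  by_cases h : Y = exchange m n X
  · rw [if_pos h, if_pos (by rw [h, exchange_exchange])]
  · rw [if_neg h, if_neg (fun h' => h (by rw [h', exchange_exchange]))]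

omit [Fintype C] in
/-- The proposal is non-negative. [cite: HukushimaNemoto1996, §2] -/
theorem exchangeProposal_nonneg (m n : Fin M) (X Y : Fin M → C) : 0 ≤ exchangeProposal m n X Y := by
  unfold exchangeProposal; split_ifs <;> norm_num

/-- The replica-exchange Markov kernel on the extended state space: the tree's Metropolis–Hastings
kernel for the exchange proposal and the extended-ensemble weight.
[cite: HukushimaNemoto1996, §2 eqs. (4), (7); GubernatisKawashimaWerner2016, §2.5.1–§2.5.2] -/
def exchangeKernel (H : C → ℝ) (β : Fin M → ℝ) (m n : Fin M) : (Fin M → C) → (Fin M → C) → ℝ :=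
  mhKernel (exchangeProposal m n) (extWeight H β)

/-- **The kernel's exchange entry is the printed acceptance (7)**: for `X' = exchange m n X ≠ X`,
`P(X → X') = min{1, e^{−Δ}}`. [cite: HukushimaNemoto1996, §2 eq. (7)] -/
theorem exchangeKernel_apply (H : C → ℝ) (β : Fin M → ℝ) {m n : Fin M} (hmn : m ≠ n)
    {X : Fin M → C} (hX : exchange m n X ≠ X) :
    exchangeKernel H β m n X (exchange m n X) = acceptance H β m n X := by
  unfold exchangeKernel
  rw [mhKernel_of_ne hX, mhRate_of_symm (exchangeProposal_symm m n) (exchangeProposal_nonneg m n)]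
  unfold exchangeProposal acceptance
  rw [if_pos rfl, one_mul, extWeight_exchange H β hmn, mul_div_assoc,
    div_self (extWeight_pos H β X).ne', mul_one]

/-- **The product Gibbs weight is stationary for the replica-exchange kernel** — “In order that
the system remains at equilibrium, it is sufficient to impose the detailed balance condition”.
[cite: HukushimaNemoto1996, §2 (sentence before eq. (4)); GubernatisKawashimaWerner2016, §2.4.1] -/
theorem extWeight_isStationary_exchangeKernel (H : C → ℝ) (β : Fin M → ℝ) (m n : Fin M) :
    IsStationary (extWeight H β) (exchangeKernel H β m n) :=
  mhKernel_isStationary (extWeight_pos H β) _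

/-- Detailed balance of the kernel (every pair of states). [cite: HukushimaNemoto1996, §2 eq. (4)] -/
theorem exchangeKernel_detailedBalance (H : C → ℝ) (β : Fin M → ℝ) (m n : Fin M) :
    DetailedBalance (extWeight H β) (exchangeKernel H β m n) :=
  mhKernel_detailedBalance (extWeight_pos H β) _

/-- The kernel is a stochastic matrix: non-negative entries and unit row sums.
[cite: GubernatisKawashimaWerner2016, §2.5.1] -/
theorem exchangeKernel_sum_eq_one (H : C → ℝ) (β : Fin M → ℝ) (m n : Fin M) (X : Fin M → C) :
    ∑ Y, exchangeKernel H β m n X Y = 1 :=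
  mhKernel_sum_eq_one _ _ X

/-- Non-negative entries. [cite: GubernatisKawashimaWerner2016, §2.5.1] -/
theorem exchangeKernel_nonneg (H : C → ℝ) (β : Fin M → ℝ) (m n : Fin M) (X Y : Fin M → C) :
    0 ≤ exchangeKernel H β m n X Y :=
  mhKernel_nonneg (exchangeProposal_nonneg m n)
    (fun X => by
      unfold exchangeProposal
      rw [Finset.sum_ite_eq' univ (exchange m n X), if_pos (mem_univ _)])
    (extWeight_pos H β) X Y

end Kernel

end Literature.Probability.MarkovChains.ReplicaExchange
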